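import Literature.Algebra.Module.CompositionMultiplicityDirectSum
import Mathlib.LinearAlgebra.Projection
import Mathlib.RingTheory.SimpleModule.Basic
import HarnessLib

/-!
# Composition factor multiplicities of completely reducible modules: `[I₁ ⊕ ⋯ ⊕ I_k : S] = #{i | Iᵢ ≅ S}`, occurrence by
# homomorphisms, and occurrence in a semisimple module (Berrick–Keating §4.1.13–4.1.18; Knapp–Vogan App. A §3)

Family `hodge`, lane `lit-hodgefound` (foundations library; seat `lit-hodgefound-p39`, generation 33, row g33-#11); topic
`Algebra/Module`, namespace `Literature.Algebra.Module.JordanHoelder` (continued).  Sequel of `CompositionMultiplicity` (g33-#1/#7) and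
`CompositionMultiplicityDirectSum` (g33-#9) over an ARBITRARY ring `R`.  Berrick–Keating §4.1.15: «`M` is completely reducible if
`M = I₁ ⊕ ⋯ ⊕ I_k` for a finite set of minimal submodules … `M` then has a composition series `0 ⊂ I₁ ⊂ I₁ ⊕ I₂ ⊂ ⋯` with composition
factors `{I₁, …, I_k}`» — here COUNTED WITH MULTIPLICITY, `[M : S] = #{i | Iᵢ ≅ S}` and `ℓ(M) = k`; §4.1.16 (the Complete Reducibility
Theorem: an Artinian semisimple module is completely reducible — via Mathlib's `IsSemisimpleModule.exists_sSupIndep_sSup_simples_eq_top`);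
§4.1.17 (i) («`M ≅ M′ ⊕ M″`» for a submodule of a semisimple module — whence an occurring simple module is both a submodule and a
quotient); and the elementary occurrence criteria from non-zero homomorphisms out of / into a simple module (§4.1.13 + Schur).
Theorems only, 0 `sorry`, no named fact (net debt 0, D-0026).

## The sources

A. J. Berrick, M. E. Keating, *An Introduction to Rings and Modules* (2000) [BerrickKeating2000, §4.1.13, Lemma 4.1.14, §4.1.15,
Thm. 4.1.16, Thm. 4.1.17, Cor. 4.1.18, pp. 135–137]; A. W. Knapp, D. A. Vogan (1995) [KnappVogan1995, App. A §3 Cor. A.27].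

## What is formalised

* §1 occurrence from homomorphisms (any `M` of finite length, `S` simple): `compMult_pos_of_injective`, `compMult_pos_of_linearMap_ne_zero`
  (a non-zero `S → M`), `compMult_pos_of_surjective`, `compMult_pos_of_linearMap_ne_zero'` (a non-zero `M → S`).
* §2 `M` SEMISIMPLE: `exists_surjective_of_compMult_pos`, `exists_injective_of_compMult_pos`, `exists_submodule_linearEquiv_of_compMult_pos`
  (an occurring `S` is a quotient and a submodule — Lemma 4.1.14 / Thm. 4.1.17 (i)), `compMult_pos_iff_exists_injective`,
  `compMult_pos_iff_exists_surjective`.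
* §3 completely reducible `M = ⊕ i, A i`, `A i` simple: `isFiniteLength_of_isSimpleModule`, **`compMult_eq_card_of_isInternal :
  [M : S] = #{i | A i ≅ S}`** (§4.1.15 counted), **`length_eq_card_of_isInternal : ℓ(M) = #ι`**, `finite_of_isInternal_of_isSimpleModule`,
  `isSemisimpleModule_of_isInternal`.
* §4 **`exists_isInternal_isSimpleModule`** (Thm. 4.1.16 / Cor. 4.1.18: a semisimple module of finite length is `I₁ ⊕ ⋯ ⊕ I_k` with the
  `Iᵢ` simple), `exists_isInternal_compMult_eq_card` (hence `[M : S]` is a summand count).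

## Mathlib / Literature search

Mathlib: `IsSemisimpleModule` (= `ComplementedLattice (Submodule R M)`), `exists_isCompl`, `Submodule.projectionOnto(_surjective)`,
`Submodule.quotientEquivOfIsCompl`, `LinearMap.quotKerEquivOfSurjective`, `LinearMap.injective_of_ne_zero` / `surjective_of_ne_zero`
(Schur), `IsSemisimpleModule.exists_sSupIndep_sSup_simples_eq_top`, `sSupIndep_iff`, `isSemisimpleModule_of_isSemisimpleModule_submodule'`,
`Module.length_eq_one`; no multiplicity count (`rg "card.*IsSimpleModule.*IsInternal"` → nothing).  Literature: g33-#1/#7/#9 `JordanHoelder.*`.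

## References

* A. J. Berrick, M. E. Keating, *An Introduction to Rings and Modules with K-theory in view*, Cambridge Stud. Adv. Math. 65, CUP (2000),
  §4.1.13–Cor. 4.1.18. [BerrickKeating2000]
* A. W. Knapp, D. A. Vogan, *Cohomological Induction and Unitary Representations*, Princeton (1995), App. A §3 Cor. A.27. [KnappVogan1995]
-/

namespace Literature.Algebra.Module

namespace JordanHoelder

open DirectSum

variable {R : Type*} [Ring R] {M : Type*} [AddCommGroup M] [Module R M]
  (S : Type*) [AddCommGroup S] [Module R S]

/-! ## §1 Occurrence from homomorphisms -/

/-- **A simple module embedded in a module `M` of finite length occurs in `M`**: `[M : S] ≥ 1` (its image is a minimal submodule).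
[cite: BerrickKeating2000, §4.1.13, Thm. 4.1.12 (ii)] [cite: KnappVogan1995, App. A §3 Cor. A.27] -/
theorem compMult_pos_of_injective [IsSimpleModule R S] (hM : IsFiniteLength R M) (f : S →ₗ[R] M)
    (hf : Function.Injective f) : 0 < compMult R M S := by
  haveI : IsSimpleModule R (LinearMap.range f) := IsSimpleModule.congr (LinearEquiv.ofInjective f hf).symm
  exact compMult_pos_of_isSimpleModule_submodule S hM (LinearMap.range f) (LinearEquiv.ofInjective f hf).symm

/-- A NON-ZERO homomorphism out of a simple module is injective (Schur), so its target (of finite length) contains `S` as a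
composition factor. [cite: BerrickKeating2000, §4.1.13] [cite: KnappVogan1995, App. A §3 Cor. A.27] -/
theorem compMult_pos_of_linearMap_ne_zero [IsSimpleModule R S] (hM : IsFiniteLength R M) (f : S →ₗ[R] M) (hf : f ≠ 0) :
    0 < compMult R M S :=
  compMult_pos_of_injective S hM f (LinearMap.injective_of_ne_zero hf)

/-- **A simple quotient of a module of finite length occurs in it**: surjective `M → S` ⟹ `[M : S] ≥ 1`.
[cite: BerrickKeating2000, Thm. 4.1.12 (ii)] [cite: KnappVogan1995, App. A §3 Cor. A.27] -/
theorem compMult_pos_of_surjective [IsSimpleModule R S] (hM : IsFiniteLength R M) (g : M →ₗ[R] S)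
    (hg : Function.Surjective g) : 0 < compMult R M S := by
  haveI : IsSimpleModule R (M ⧸ LinearMap.ker g) := IsSimpleModule.congr (g.quotKerEquivOfSurjective hg)
  exact compMult_pos_of_isSimpleModule_quotient S hM (LinearMap.ker g) (g.quotKerEquivOfSurjective hg)

/-- A NON-ZERO homomorphism into a simple module is surjective (Schur), so its source (of finite length) has `S` as a composition
factor. [cite: BerrickKeating2000, §4.1.13] [cite: KnappVogan1995, App. A §3 Cor. A.27] -/
theorem compMult_pos_of_linearMap_ne_zero' [IsSimpleModule R S] (hM : IsFiniteLength R M) (g : M →ₗ[R] S) (hg : g ≠ 0) :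
    0 < compMult R M S :=
  compMult_pos_of_surjective S hM g (LinearMap.surjective_of_ne_zero hg)

/-! ## §2 Occurrence in a semisimple module: submodule ⟺ quotient ⟺ composition factor -/

/-- **In a SEMISIMPLE module an occurring `S` is a quotient**: a composition factor `Y/X ≅ S` with `M = Y ⊕ Y′` gives
`M ↠ Y ↠ Y/X ≅ S` («`M ≅ M′ ⊕ M″`»). [cite: BerrickKeating2000, Lemma 4.1.14, Thm. 4.1.17 (i)] -/
theorem exists_surjective_of_compMult_pos [IsSemisimpleModule R M] (h : 0 < compMult R M S) :
    ∃ g : M →ₗ[R] S, Function.Surjective g := by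
  obtain ⟨X, Y, _, ⟨e⟩⟩ := exists_covBy_of_compMult_pos S h
  obtain ⟨Y', hYY'⟩ := exists_isCompl Y
  refine ⟨(e.toLinearMap ∘ₗ (X.comap Y.subtype).mkQ) ∘ₗ Submodule.projectionOnto Y Y' hYY', ?_⟩
  exact (e.surjective.comp (Submodule.mkQ_surjective _)).comp (Submodule.projectionOnto_surjective hYY')

/-- **In a SEMISIMPLE module an occurring `S` is a submodule**: a quotient `M/K ≅ S` with `M = K ⊕ C` gives `S ≅ C ≤ M`.
[cite: BerrickKeating2000, Lemma 4.1.14, Thm. 4.1.17 (i)] -/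
theorem exists_injective_of_compMult_pos [IsSemisimpleModule R M] (h : 0 < compMult R M S) :
    ∃ f : S →ₗ[R] M, Function.Injective f := by
  obtain ⟨g, hg⟩ := exists_surjective_of_compMult_pos S h
  obtain ⟨C, hC⟩ := exists_isCompl (LinearMap.ker g)
  refine ⟨C.subtype ∘ₗ ((g.quotKerEquivOfSurjective hg).symm.trans (Submodule.quotientEquivOfIsCompl _ C hC)).toLinearMap, ?_⟩
  exact (Submodule.subtype_injective C).comp (LinearEquiv.injective _)

/-- … as a submodule `K ≤ M` with `K ≅ S`. [cite: BerrickKeating2000, Lemma 4.1.14, Thm. 4.1.17 (i)] -/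
theorem exists_submodule_linearEquiv_of_compMult_pos [IsSemisimpleModule R M] (h : 0 < compMult R M S) :
    ∃ K : Submodule R M, Nonempty (K ≃ₗ[R] S) := by
  obtain ⟨f, hf⟩ := exists_injective_of_compMult_pos S h
  exact ⟨LinearMap.range f, ⟨(LinearEquiv.ofInjective f hf).symm⟩⟩

/-- **For a semisimple module of finite length and a simple `S`: `[M : S] ≥ 1` iff `S` embeds in `M`.**
[cite: BerrickKeating2000, §4.1.13, Thm. 4.1.17 (i)] [cite: KnappVogan1995, App. A §3 Cor. A.27] -/
theorem compMult_pos_iff_exists_injective [IsSemisimpleModule R M] [IsSimpleModule R S] (hM : IsFiniteLength R M) :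
    0 < compMult R M S ↔ ∃ f : S →ₗ[R] M, Function.Injective f :=
  ⟨exists_injective_of_compMult_pos S, fun ⟨f, hf⟩ => compMult_pos_of_injective S hM f hf⟩

/-- **For a semisimple module of finite length and a simple `S`: `[M : S] ≥ 1` iff `S` is a quotient of `M`.**
[cite: BerrickKeating2000, Thm. 4.1.17 (i)] [cite: KnappVogan1995, App. A §3 Cor. A.27] -/
theorem compMult_pos_iff_exists_surjective [IsSemisimpleModule R M] [IsSimpleModule R S] (hM : IsFiniteLength R M) :
    0 < compMult R M S ↔ ∃ g : M →ₗ[R] S, Function.Surjective g :=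
  ⟨exists_surjective_of_compMult_pos S, fun ⟨g, hg⟩ => compMult_pos_of_surjective S hM g hg⟩

/-! ## §3 Completely reducible modules `M = I₁ ⊕ ⋯ ⊕ I_k` -/

/-- A simple module has finite length (`ℓ = 1`). [cite: BerrickKeating2000, §4.1.15] -/
theorem isFiniteLength_of_isSimpleModule (K : Type*) [AddCommGroup K] [Module R K] [IsSimpleModule R K] :
    IsFiniteLength R K := by
  rw [← Module.length_ne_top_iff, Module.length_eq_one]
  exact ENat.one_ne_top

section Decomposition

variable {ι : Type*} [DecidableEq ι] (A : ι → Submodule R M)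

/-- **`[I₁ ⊕ ⋯ ⊕ I_k : S] = #{i | Iᵢ ≅ S}`** for an internal direct sum decomposition into SIMPLE submodules over a finite index type
(«composition factors `{I₁, …, I_k}`», counted with multiplicity). [cite: BerrickKeating2000, §4.1.15, Thm. 4.1.12 (ii)]
[cite: KnappVogan1995, App. A §3 Cor. A.27] -/
theorem compMult_eq_card_of_isInternal [Fintype ι] (h : DirectSum.IsInternal A) [∀ i, IsSimpleModule R (A i)]
    [DecidablePred fun i => Nonempty (A i ≃ₗ[R] S)] :
    compMult R M S = (Finset.univ.filter fun i => Nonempty (A i ≃ₗ[R] S)).card := by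
  rw [compMult_eq_sum_of_isInternal S A h fun i => isFiniteLength_of_isSimpleModule (A i), Finset.card_filter]
  exact Finset.sum_congr rfl fun i _ => compMult_of_isSimpleModule S

/-- **`ℓ(I₁ ⊕ ⋯ ⊕ I_k) = k`** (the displayed composition series of §4.1.15 has length `k`). [cite: BerrickKeating2000, §4.1.15]
[cite: KnappVogan1995, App. A §3 Cor. A.27] -/
theorem length_eq_card_of_isInternal [Fintype ι] (h : DirectSum.IsInternal A) [∀ i, IsSimpleModule R (A i)] :
    Module.length R M = Fintype.card ι := by
  rw [length_eq_sum_of_isInternal A h]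
  simp only [Module.length_eq_one, Finset.sum_const, Finset.card_univ, nsmul_eq_mul, mul_one]

/-- A module of finite length is the direct sum of only FINITELY many simple submodules («the index set `Λ` must be finite, since
otherwise we could construct an infinite descending chain»). [cite: BerrickKeating2000, Thm. 4.1.16 (proof), Cor. 4.1.18] -/
theorem finite_of_isInternal_of_isSimpleModule (h : DirectSum.IsInternal A) [∀ i, IsSimpleModule R (A i)]
    (hM : IsFiniteLength R M) : Finite ι := by
  have hfin := finite_ne_bot_of_isInternal A h hM
  have huniv : {i | A i ≠ ⊥} = Set.univ :=
    Set.eq_univ_of_forall fun i => (Submodule.nontrivial_iff_ne_bot).mp (IsSimpleModule.nontrivial R (A i))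
  rw [huniv] at hfin
  exact Set.finite_univ_iff.mp hfin

omit [DecidableEq ι] in
/-- A direct sum of simple submodules is semisimple (Mathlib's `isSemisimpleModule_of_isSemisimpleModule_submodule'`).
[cite: BerrickKeating2000, §4.1.13, §4.1.15] -/
theorem isSemisimpleModule_of_iSup_eq_top [∀ i, IsSimpleModule R (A i)] (h : ⨆ i, A i = ⊤) : IsSemisimpleModule R M :=
  isSemisimpleModule_of_isSemisimpleModule_submodule' (fun _ => inferInstance) h

/-- A completely reducible module is semisimple. [cite: BerrickKeating2000, §4.1.15] -/
theorem isSemisimpleModule_of_isInternal (h : DirectSum.IsInternal A) [∀ i, IsSimpleModule R (A i)] : IsSemisimpleModule R M :=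
  isSemisimpleModule_of_iSup_eq_top A h.submodule_iSup_eq_top

end Decomposition

/-! ## §4 The Complete Reducibility Theorem (Berrick–Keating Thm. 4.1.16, Cor. 4.1.18) -/

/-- **A semisimple module of finite length is completely reducible: `M = I₁ ⊕ ⋯ ⊕ I_k` with the `Iᵢ` simple submodules** (Mathlib's
`IsSemisimpleModule.exists_sSupIndep_sSup_simples_eq_top`, the index set finite by finite length, re-indexed by `Fin k`).
[cite: BerrickKeating2000, Thm. 4.1.16, Cor. 4.1.18] -/
theorem exists_isInternal_isSimpleModule [IsSemisimpleModule R M] (hM : IsFiniteLength R M) :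
    ∃ (k : ℕ) (A : Fin k → Submodule R M), DirectSum.IsInternal A ∧ ∀ i, IsSimpleModule R (A i) := by
  classical
  obtain ⟨s, hind, hsup, hsimple⟩ := IsSemisimpleModule.exists_sSupIndep_sSup_simples_eq_top R M
  rw [sSupIndep_iff] at hind
  rw [sSup_eq_iSup'] at hsup
  have hint : DirectSum.IsInternal (fun m : s => (m : Submodule R M)) :=
    DirectSum.isInternal_submodule_of_iSupIndep_of_iSup_eq_top hind hsup
  haveI : ∀ m : s, IsSimpleModule R ((fun m : s => (m : Submodule R M)) m) := fun m => hsimple m m.2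
  haveI : Finite s := finite_of_isInternal_of_isSimpleModule (fun m : s => (m : Submodule R M)) hint hM
  let e := Finite.equivFin s
  refine ⟨Nat.card s, fun i => (e.symm i : Submodule R M), ?_, fun i => hsimple _ (e.symm i).2⟩
  rw [DirectSum.isInternal_submodule_iff_iSupIndep_and_iSup_eq_top]
  refine ⟨hind.comp e.symm.injective, ?_⟩
  rw [e.symm.surjective.iSup_comp fun m : s => (m : Submodule R M)]
  exact hsup

/-- **Hence `[M : S]` of a semisimple module of finite length is a summand count**: there is `M = I₁ ⊕ ⋯ ⊕ I_k`, `Iᵢ` simple, with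
`[M : S] = #{i | Iᵢ ≅ S}` for every `S` and `ℓ(M) = k`. [cite: BerrickKeating2000, §4.1.15, Thm. 4.1.16] [cite: KnappVogan1995, App. A §3 Cor. A.27] -/
theorem exists_isInternal_compMult_eq_card [IsSemisimpleModule R M] (hM : IsFiniteLength R M) :
    ∃ (k : ℕ) (A : Fin k → Submodule R M), DirectSum.IsInternal A ∧ (∀ i, IsSimpleModule R (A i)) ∧
      Module.length R M = k ∧
      ∀ (S : Type*) [AddCommGroup S] [Module R S] [DecidablePred fun i => Nonempty (A i ≃ₗ[R] S)],
        compMult R M S = (Finset.univ.filter fun i => Nonempty (A i ≃ₗ[R] S)).card := by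
  obtain ⟨k, A, h, hs⟩ := exists_isInternal_isSimpleModule hM
  refine ⟨k, A, h, hs, ?_, fun S _ _ _ => ?_⟩
  · rw [length_eq_card_of_isInternal A h, Fintype.card_fin]
  · exact compMult_eq_card_of_isInternal S A h

end JordanHoelder

end Literature.Algebra.Module
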